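import Mathlib
import HarnessLib
import Summits.ValiantsHypothesis.ValiantsHypothesis.Theses.MonotoneRestoration
import Literature.Computability.AlgebraicComplexity.SymmetricCircuitHadamard

/-! # Route MonotoneRestoration — crux `MonotoneRestorationQP`, line Sketch, stub Z4
(stmt-ValiantsHypothesis-15886)

**Hadamard (entrywise) product of two equivariant output families.** If a `Γ`-symmetric
Dawar–Wilsenach labelled arithmetic circuit over the constants `K` and the variables `X`
computes two families `(a_y)_y`, `(b_y)_y` at outputs indexed by the `Γ`-set `Y ⊕ Y` (as
delivered by the pairing of two `Γ`-symmetric circuits with outputs indexed by `Y`, stub E2 /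
`LabelledArithCircuit.IsSymmetric.exists_pairing`), then the family `(a_y · b_y)_{y ∈ Y}` is
computed at outputs indexed by `Y` by a `Γ`-symmetric circuit on at most `|G| + |Y|` gates.

Proof: the universe-`0` instance of the tree lemma
`LabelledArithCircuit.IsSymmetric.exists_hadamard`
(`Literature/Computability/AlgebraicComplexity/SymmetricCircuitHadamard.lean`): gate set `G ⊕ Y`,
one new multiplication gate `Sum.inr y` per index over the two (distinct) output gates indexed
`Sum.inl y`, `Sum.inr y`; an automorphism `π` extending `γ` extends as `π ⊕ (γ • ·)`.
-/

noncomputable section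

-- `Summit.ValiantsHypothesis.ValiantsHypothesis.…` is the tree's mandated namespace (Sub = Summit).
set_option linter.dupNamespace false

namespace Summit.ValiantsHypothesis.ValiantsHypothesis.Theorems

open Literature.Computability.AlgebraicComplexity

/-- **Z4 — Hadamard (entrywise) product of two equivariant output families** (crux
`MonotoneRestorationQP`, line Sketch; registered stub `stub_symmetric_hadamardOutputs`): if a
`Γ`-symmetric circuit computes two families `(a_y)_y`, `(b_y)_y` at outputs indexed by `Y ⊕ Y`,
then `(a_y · b_y)_{y ∈ Y}` is computed at outputs indexed by `Y` by a `Γ`-symmetric circuit on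
at most `|G| + |Y|` gates (one product gate per `y` over the two output gates `inl y`, `inr y`).
Instance of `LabelledArithCircuit.IsSymmetric.exists_hadamard`. -/
theorem stub_symmetric_hadamardOutputs {K X Y Γ G : Type} [CommSemiring K] [Group Γ]
    [MulAction Γ X] [MulAction Γ Y] [Fintype Y] [DecidableEq Y] [Fintype G]
    (C : LabelledArithCircuit K X (Y ⊕ Y) G) (hC : C.IsSymmetric Γ) :
    ∃ (G' : Type) (_ : Fintype G') (C' : LabelledArithCircuit K X Y G'),
      C'.IsSymmetric Γ ∧
      (∀ y, C'.eval (C'.output y) =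
        C.eval (C.output (Sum.inl y)) * C.eval (C.output (Sum.inr y))) ∧
      Fintype.card G' ≤ Fintype.card G + Fintype.card Y :=
  hC.exists_hadamard

end Summit.ValiantsHypothesis.ValiantsHypothesis.Theorems

end
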